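import Mathlib.Analysis.InnerProductSpace.PiL2
import Mathlib.Analysis.SpecialFunctions.Sqrt
import Literature.Analysis.FluidPDE.NashGeometricLemma
import HarnessLib

/-!
# The two geometric lemmas of De Lellis–Kwon 2022, §3.1: the six-direction basis lemma
# (Lemma 3.2) for `{(1,±1,0), (1,0,±1), (0,1,±1)}` and the orthogonal-frame lemma (Lemma 3.3)

Analysis/FluidPDE support file on the discharge path of `Torus.DeLellisKwon2022_thm11`
(everything proved; no named facts). C. De Lellis, H. Kwon, Anal. PDE 15 (2022) =
arXiv:2006.06482, §3.1, choose the directions of the Mikado flows of their scheme with two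
elementary lemmas:

> **Lemma 3.2 (Geometric Lemma I).** Let `𝓕 = {f_i}_{i=1}^6 ⊂ ℤ³` and `C > 0` be such that
> `∑ f_i ⊗ f_i = C Id` and `{f_i ⊗ f_i}` forms a basis of the symmetric matrices. Then there is
> `N₀ = N₀(𝓕) > 0` such that for any `N ≤ N₀` there are `Γ_{f_i} ∈ C^∞(S_N; (0,∞))`,
> `S_N = {Id - K : K symmetric, |K|_∞ ≤ N}`, with `Id - K = ∑ Γ²_{f_i}(Id - K) f_i ⊗ f_i`.
> (Proof: the coordinate functionals `L_i` of the basis, `L_i(Id) = 1/C`, `Γ_{f_i} = √L_i`.)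

> **Lemma 3.3 (Geometric Lemma II).** Suppose `{f₁, f₂, f₃} ⊂ ℤ³ ∖ {0}` is an orthogonal frame and
> `f₄ = -(f₁ + f₂ + f₃)`. Then for any `N₀ > 0` there are affine functions
> `Γ_{f_k} ∈ C^∞(𝒱_{N₀}; [N₀, ∞))`, `𝒱_{N₀} = {|u| ≤ N₀}`, with `u = ∑_{k=1}^4 Γ_{f_k}(u) f_k`.
> (Proof: `Γ_{f_k}(u) = 2N₀ + u·f_k/|f_k|²` for `k ≤ 3`, `Γ_{f₄} = 2N₀`.)

applied to the family `𝓕^{0,R} = {(1,±1,0), (1,0,±1), (0,1,±1)}` (and 26 rotated/rescaled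
copies) resp. to `𝓕^{0,φ} = {(1,2,0), (-2,1,0), (0,0,1), (1,-3,-1)}`. This file PROVES both, in the
conventions of the tree's `NashGeometricLemma` / `BeltramiGeometricLemma` (matrices as
`Fin 3 → Fin 3 → ℝ` with the sup distance `dist M Id = |M - Id|_∞`, `NashGeometric.idMat`):

* `DLK.sixDir : Fin 6 → Fin 3 → ℤ` — the six directions, with `∑ f_i ⊗ f_i = 4 Id`
  (`DLK.sum_sixDir_mul_sixDir`);
* `DLK.sixCoeffSq M i` — the coordinate functionals `L_i(M)` (explicit, LINEAR in `M`), the linear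
  identity `M = ∑ L_i(M) f_i ⊗ f_i` for every symmetric `M` (`DLK.six_identity`) and its uniqueness
  (`DLK.eq_sixCoeffSq_of_sum_eq`: the six rank-one matrices form a basis), `L_i(Id) = 1/4`;
* `DLK.sixCoeff i = √L_i`: `L_i ≥ 1/8` on `|M - Id|_∞ ≤ 1/10` (`DLK.le_sixCoeffSq`), `L_i > 0` and
  `Γ_i` smooth on the open sup-ball of radius `1/5` (`DLK.contDiffOn_sixCoeff`), the decomposition
  with genuine squares `M_ab = ∑ Γ_i(M)² (f_i)_a (f_i)_b` there (`DLK.six_decomposition`), bounded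
  derivatives of every order on `|M - Id|_∞ ≤ 1/10` (`DLK.exists_bound_iteratedFDeriv_sixCoeff`),
  and the packaged printed shape `DLK.geometric_lemma_six` (`N₀ = 1/10`);
* `DLK.frameCoeff f N₀ k u` — the affine coefficients of Lemma 3.3 for a frame
  `f : Fin 4 → ℝ³` (`EuclideanSpace`), with `u = ∑ₖ Γ_k(u) f_k` (`DLK.sum_frameCoeff_smul`),
  `Γ_k(u) ≥ N₀` for `|u| ≤ N₀` when `|f_k| ≥ 1` (`DLK.le_frameCoeff`), smoothness and the packaged
  `DLK.geometric_lemma_frame`.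

## Mathlib / tree search

Tree: `NashGeometric.idMat`, `abs_sub_idMat_le` (`NashGeometricLemma`, CL22 Lemma 4.2 with
fifteen directions — not a basis), `IntermittentBeltrami.geometric_lemma` (BV19/Luo–Titi, six
`Id - ξ ⊗ ξ`), `CP25.nash_lemma` (Coiculescu–Palasek's six directions): none is DLK's family nor the
frame lemma (`lean search 'Geometric Lemma II|orthogonal frame|frameCoeff'`: nothing). Mathlib:
`linearIndependent_of_ne_zero_of_inner_eq_zero`, `basisOfLinearIndependentOfCardEqFinrank`,
`ContDiffOn.sqrt`.

## References

* C. De Lellis, H. Kwon, *On nonuniqueness of Hölder continuous globally dissipative Euler flows*,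
  Anal. PDE 15 (2022) = arXiv:2006.06482, §3.1, Lemma 3.2, Lemma 3.3 and the display following
  them (the families `𝓕^{j,R}`, `𝓕^{j,φ}`). [DelellisKwon2022]
* C. De Lellis, L. Székelyhidi Jr., *Dissipative continuous Euler flows*, Invent. Math. 193 (2013),
  Lemma 3.2 (the original geometric lemma). [DeLellisSzekelyhidiInvent2013]
-/

noncomputable section

open Set Metric Function
open scoped InnerProductSpace RealInnerProductSpace ContDiff

namespace Literature.Analysis.FluidPDE

namespace DLK

open NashGeometric

/-! ## Lemma 3.2 for the six directions `(1,±1,0), (1,0,±1), (0,1,±1)` -/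

section Six

/-- The six directions `f₀ = (1,1,0)`, `f₁ = (1,-1,0)`, `f₂ = (1,0,1)`, `f₃ = (1,0,-1)`,
`f₄ = (0,1,1)`, `f₅ = (0,1,-1)` of the family `𝓕^{0,R}`. [cite: DelellisKwon2022, §3.1 (display after Lemma 3.3)] -/
def sixDir : Fin 6 → Fin 3 → ℤ :=
  ![![1, 1, 0], ![1, -1, 0], ![1, 0, 1], ![1, 0, -1], ![0, 1, 1], ![0, 1, -1]]

/-- **`∑ᵢ fᵢ ⊗ fᵢ = 4 Id`** (condition (3.3) with `C = 4`). [cite: DelellisKwon2022, §3.1 (3.3)] -/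
theorem sum_sixDir_mul_sixDir (a b : Fin 3) :
    ∑ i, ((sixDir i a : ℤ) : ℝ) * ((sixDir i b : ℤ) : ℝ) = 4 * idMat a b := by
  fin_cases a <;> fin_cases b <;>
    simp [sixDir, Fin.sum_univ_succ, idMat, Matrix.cons_val_zero, Matrix.cons_val_one] <;> norm_num

/-- The coordinate functionals `L_i(M)` of the basis `{f_i ⊗ f_i}`: with
`s₀₁ = (M₀₀ + M₁₁ - M₂₂)/2`, `s₀₂ = (M₀₀ - M₁₁ + M₂₂)/2`, `s₁₂ = (-M₀₀ + M₁₁ + M₂₂)/2`,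
`L₀,₁ = (s₀₁ ± M₀₁)/2`, `L₂,₃ = (s₀₂ ± M₀₂)/2`, `L₄,₅ = (s₁₂ ± M₁₂)/2` (linear in `M`). [cite: DelellisKwon2022, Lemma 3.2 (proof: the maps L_i)] -/
def sixCoeffSq (M : Fin 3 → Fin 3 → ℝ) : Fin 6 → ℝ :=
  ![((M 0 0 + M 1 1 - M 2 2) / 2 + M 0 1) / 2, ((M 0 0 + M 1 1 - M 2 2) / 2 - M 0 1) / 2,
    ((M 0 0 - M 1 1 + M 2 2) / 2 + M 0 2) / 2, ((M 0 0 - M 1 1 + M 2 2) / 2 - M 0 2) / 2,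
    ((-M 0 0 + M 1 1 + M 2 2) / 2 + M 1 2) / 2, ((-M 0 0 + M 1 1 + M 2 2) / 2 - M 1 2) / 2]

/-- **The linear identity** `M_ab = ∑ᵢ Lᵢ(M) (fᵢ)_a (fᵢ)_b` for every symmetric `M`. [cite: DelellisKwon2022, Lemma 3.2 (proof)] -/
theorem six_identity {M : Fin 3 → Fin 3 → ℝ} (hsym : ∀ i j, M i j = M j i) (a b : Fin 3) :
    M a b = ∑ i, sixCoeffSq M i * (((sixDir i a : ℤ) : ℝ) * ((sixDir i b : ℤ) : ℝ)) := by
  have h10 := hsym 1 0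
  have h20 := hsym 2 0
  have h21 := hsym 2 1
  fin_cases a <;> fin_cases b <;>
    simp [sixDir, sixCoeffSq, Fin.sum_univ_succ, Matrix.cons_val_zero, Matrix.cons_val_one] <;>
    linarith

/-- **Uniqueness of the coefficients** (the six matrices `fᵢ ⊗ fᵢ` are linearly independent, hence
a basis of the symmetric `3 × 3` matrices): if `M_ab = ∑ᵢ cᵢ (fᵢ)_a (fᵢ)_b` then `c = L(M)`. [cite: DelellisKwon2022, Lemma 3.2 (hypothesis (3.3): basis)] -/
theorem eq_sixCoeffSq_of_sum_eq {M : Fin 3 → Fin 3 → ℝ} {c : Fin 6 → ℝ}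
    (h : ∀ a b, M a b = ∑ i, c i * (((sixDir i a : ℤ) : ℝ) * ((sixDir i b : ℤ) : ℝ))) :
    c = sixCoeffSq M := by
  have h00 := h 0 0
  have h11 := h 1 1
  have h22 := h 2 2
  have h01 := h 0 1
  have h02 := h 0 2
  have h12 := h 1 2
  simp [sixDir, Fin.sum_univ_succ, Matrix.cons_val_zero, Matrix.cons_val_one] at h00 h11 h22 h01 h02 h12
  funext i
  fin_cases i <;> simp [sixCoeffSq] <;> linarith

/-- `Lᵢ(Id) = 1/4` (`= 1/C`). [cite: DelellisKwon2022, Lemma 3.2 (proof: L_i(Id) = 1/C)] -/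
theorem sixCoeffSq_idMat (i : Fin 6) : sixCoeffSq idMat i = 1 / 4 := by
  fin_cases i <;> simp [sixCoeffSq, idMat] <;> norm_num

/-- `Lᵢ` is `5/4`-Lipschitz for the sup distance to `Id`: `|Lᵢ(M) - 1/4| ≤ (5/4) |M - Id|_∞`. [folklore] -/
theorem abs_sixCoeffSq_sub_le {M : Fin 3 → Fin 3 → ℝ} {ρ : ℝ} (hM : dist M idMat ≤ ρ) (i : Fin 6) :
    |sixCoeffSq M i - 1 / 4| ≤ 5 / 4 * ρ := by
  have h00 := abs_sub_idMat_le hM 0 0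
  have h11 := abs_sub_idMat_le hM 1 1
  have h22 := abs_sub_idMat_le hM 2 2
  have h01 := abs_sub_idMat_le hM 0 1
  have h02 := abs_sub_idMat_le hM 0 2
  have h12 := abs_sub_idMat_le hM 1 2
  rw [idMat_apply_self] at h00 h11 h22
  rw [idMat_apply_of_ne (by decide), sub_zero] at h01 h02 h12
  rw [abs_le] at h00 h11 h22 h01 h02 h12 ⊢
  obtain ⟨h00a, h00b⟩ := h00; obtain ⟨h11a, h11b⟩ := h11; obtain ⟨h22a, h22b⟩ := h22
  obtain ⟨h01a, h01b⟩ := h01; obtain ⟨h02a, h02b⟩ := h02; obtain ⟨h12a, h12b⟩ := h12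
  fin_cases i <;> simp [sixCoeffSq] <;> constructor <;> linarith

/-- The radius `N₀ = 1/10` of the lemma for this family. [cite: DelellisKwon2022, Lemma 3.2 (N₀)] -/
def sixRadius : ℝ := 1 / 10

/-- **`Lᵢ ≥ 1/8` on `|M - Id|_∞ ≤ 1/10`.** [cite: DelellisKwon2022, Lemma 3.2 (proof: L_i ≥ 1/(2C))] -/
theorem le_sixCoeffSq {M : Fin 3 → Fin 3 → ℝ} (hM : dist M idMat ≤ sixRadius) (i : Fin 6) :
    1 / 8 ≤ sixCoeffSq M i := by
  have h := abs_sixCoeffSq_sub_le hM i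
  rw [sixRadius] at h
  have := (abs_le.1 h).1
  linarith

/-- `Lᵢ > 0` on the open sup-ball `|M - Id|_∞ < 1/5`. [folklore] -/
theorem sixCoeffSq_pos {M : Fin 3 → Fin 3 → ℝ} (hM : dist M idMat < 2 * sixRadius) (i : Fin 6) :
    0 < sixCoeffSq M i := by
  have h := abs_sixCoeffSq_sub_le (le_rfl : dist M idMat ≤ dist M idMat) i
  have := (abs_le.1 h).1
  rw [sixRadius] at hM
  linarith

/-- The coefficients `Γᵢ = √Lᵢ`. [cite: DelellisKwon2022, Lemma 3.2 (Γ_{f_i} := √L_i)] -/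
def sixCoeff (i : Fin 6) (M : Fin 3 → Fin 3 → ℝ) : ℝ := Real.sqrt (sixCoeffSq M i)

/-- `Γᵢ² = Lᵢ` wherever `Lᵢ ≥ 0`, in particular on `|M - Id|_∞ ≤ 1/5`. [folklore] -/
theorem sixCoeff_sq {M : Fin 3 → Fin 3 → ℝ} (hM : dist M idMat ≤ 2 * sixRadius) (i : Fin 6) :
    sixCoeff i M ^ 2 = sixCoeffSq M i := by
  have h := abs_sixCoeffSq_sub_le hM i
  rw [sixRadius] at h
  have := (abs_le.1 h).1
  exact Real.sq_sqrt (by linarith)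

/-- `Γᵢ > 0` on the open sup-ball of radius `1/5`. [folklore] -/
theorem sixCoeff_pos {M : Fin 3 → Fin 3 → ℝ} (hM : dist M idMat < 2 * sixRadius) (i : Fin 6) :
    0 < sixCoeff i M :=
  Real.sqrt_pos.2 (sixCoeffSq_pos hM i)

/-- **The decomposition with genuine squares**: `M_ab = ∑ᵢ Γᵢ(M)² (fᵢ)_a (fᵢ)_b` for symmetric `M`
with `|M - Id|_∞ ≤ 1/5` (so `Id - K = ∑ Γᵢ²(Id - K) fᵢ ⊗ fᵢ` for symmetric `K`, `|K|_∞ ≤ 1/5`).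
[cite: DelellisKwon2022, Lemma 3.2] -/
theorem six_decomposition {M : Fin 3 → Fin 3 → ℝ} (hsym : ∀ i j, M i j = M j i)
    (hM : dist M idMat ≤ 2 * sixRadius) (a b : Fin 3) :
    M a b = ∑ i, sixCoeff i M ^ 2 * (((sixDir i a : ℤ) : ℝ) * ((sixDir i b : ℤ) : ℝ)) := by
  rw [six_identity hsym a b]
  exact Finset.sum_congr rfl fun i _ => by rw [sixCoeff_sq hM i]

/-- The functionals `Lᵢ` are smooth (linear). [folklore] -/
theorem contDiff_sixCoeffSq (i : Fin 6) {n : WithTop ℕ∞} : ContDiff ℝ n fun M : Fin 3 → Fin 3 → ℝ => sixCoeffSq M i := by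
  have he : ∀ a b : Fin 3, ContDiff ℝ n fun M : Fin 3 → Fin 3 → ℝ => M a b := fun a b =>
    (contDiff_apply ℝ ℝ b).comp (contDiff_apply ℝ (Fin 3 → ℝ) a)
  fin_cases i <;> simp only [sixCoeffSq, Fin.zero_eta, Fin.mk_one, Fin.reduceFinMk, Matrix.cons_val_zero,
      Matrix.cons_val_one, Matrix.cons_val] <;>
    fun_prop

/-- **`Γᵢ` is smooth on the open sup-ball `|M - Id|_∞ < 1/5`.** [cite: DelellisKwon2022, Lemma 3.2 (Γ ∈ C^∞)] -/
theorem contDiffOn_sixCoeff (i : Fin 6) {n : WithTop ℕ∞} :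
    ContDiffOn ℝ n (sixCoeff i) (ball (idMat : Fin 3 → Fin 3 → ℝ) (2 * sixRadius)) :=
  (contDiff_sixCoeffSq i).contDiffOn.sqrt fun _ hM => (sixCoeffSq_pos (mem_ball.mp hM) i).ne'

/-- **Uniform bounds on all derivatives of `Γᵢ` on `|M - Id|_∞ ≤ 1/10`** (the compact sup-ball
inside the open ball of smoothness; "the smoothness of the selected functions depends only on"
the family). [cite: DelellisKwon2022, Lemma 3.2 and §3.4.2] -/
theorem exists_bound_iteratedFDeriv_sixCoeff (i : Fin 6) (m : ℕ) :
    ∃ C : ℝ, ∀ M : Fin 3 → Fin 3 → ℝ, dist M idMat ≤ sixRadius → ‖iteratedFDeriv ℝ m (sixCoeff i) M‖ ≤ C := by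
  set U : Set (Fin 3 → Fin 3 → ℝ) := ball idMat (2 * sixRadius) with hU
  have hUopen : IsOpen U := isOpen_ball
  have hsmooth : ContDiffOn ℝ ∞ (sixCoeff i) U := contDiffOn_sixCoeff i
  have hcont : ContinuousOn (iteratedFDerivWithin ℝ m (sixCoeff i) U) U :=
    hsmooth.continuousOn_iteratedFDerivWithin (by exact_mod_cast le_top) hUopen.uniqueDiffOn
  have hcont' : ContinuousOn (iteratedFDeriv ℝ m (sixCoeff i)) U :=
    hcont.congr fun M hM => (iteratedFDerivWithin_of_isOpen m hUopen hM).symm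
  have hsub : closedBall idMat sixRadius ⊆ U := by
    intro M hM
    rw [hU, mem_ball]
    exact (mem_closedBall.mp hM).trans_lt (by norm_num [sixRadius])
  obtain ⟨C, hC⟩ := (isCompact_closedBall (idMat : Fin 3 → Fin 3 → ℝ) sixRadius).exists_bound_of_continuousOn
    (hcont'.mono hsub)
  exact ⟨C, fun M hM => hC M (mem_closedBall.mpr hM)⟩

/-- **De Lellis–Kwon 2022, Lemma 3.2 (Geometric Lemma I) for `𝓕^{0,R} = {(1,±1,0), (1,0,±1), (0,1,±1)}`**,
in its printed shape: there is `N₀ > 0` (here `1/10`) such that for every `N ≤ N₀` the functions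
`Γ_{fᵢ}` are smooth and positive on `S_N = {M = Id - K : K symmetric, |K|_∞ ≤ N}` (indeed on the
open sup-ball of radius `2N₀` around `Id`) and `Id - K = ∑ᵢ Γ²_{fᵢ}(Id - K) fᵢ ⊗ fᵢ` on `S_N`.
[cite: DelellisKwon2022, Lemma 3.2] -/
theorem geometric_lemma_six :
    ∃ N₀ : ℝ, 0 < N₀ ∧
      (∀ i, ContDiffOn ℝ ∞ (sixCoeff i) (ball (idMat : Fin 3 → Fin 3 → ℝ) (2 * N₀))) ∧
      (∀ N, N ≤ N₀ → ∀ (i) (M : Fin 3 → Fin 3 → ℝ), dist M idMat ≤ N → 0 < sixCoeff i M) ∧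
      (∀ N, N ≤ N₀ → ∀ M : Fin 3 → Fin 3 → ℝ, (∀ a b, M a b = M b a) → dist M idMat ≤ N →
        ∀ a b, M a b = ∑ i, sixCoeff i M ^ 2 * (((sixDir i a : ℤ) : ℝ) * ((sixDir i b : ℤ) : ℝ))) :=
  ⟨sixRadius, by norm_num [sixRadius], fun i => contDiffOn_sixCoeff i,
    fun N hN i M hM => sixCoeff_pos (by
      have : (0 : ℝ) < sixRadius := by norm_num [sixRadius]
      linarith) i,
    fun N hN M hsym hM a b => six_decomposition hsym (by
      have : (0 : ℝ) < sixRadius := by norm_num [sixRadius]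
      linarith) a b⟩

end Six

/-! ## Lemma 3.3: the orthogonal-frame lemma -/

section Frame

/-- Euclidean `ℝ³`, local notation. -/
local notation "ℝ³" => EuclideanSpace ℝ (Fin 3)

/-- **The affine coefficients of Lemma 3.3**: `Γ_k(u) = 2N₀ + ⟪u, f_k⟫/|f_k|²` for `k = 0,1,2` and
`Γ₃(u) = 2N₀`. [cite: DelellisKwon2022, Lemma 3.3 (proof)] -/
def frameCoeff (f : Fin 4 → ℝ³) (N₀ : ℝ) (k : Fin 4) (u : ℝ³) : ℝ :=
  if k = 3 then 2 * N₀ else 2 * N₀ + ⟪u, f k⟫_ℝ / ‖f k‖ ^ 2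

variable {f : Fin 4 → ℝ³} {N₀ : ℝ}

/-- `Γ₃ = 2N₀`. [folklore] -/
@[simp] theorem frameCoeff_three (u : ℝ³) : frameCoeff f N₀ 3 u = 2 * N₀ := by
  simp [frameCoeff]

/-- `Γ_k(u) = 2N₀ + ⟪u, f_k⟫/|f_k|²` for `k ≠ 3`. [folklore] -/
theorem frameCoeff_of_ne_three {k : Fin 4} (hk : k ≠ 3) (u : ℝ³) :
    frameCoeff f N₀ k u = 2 * N₀ + ⟪u, f k⟫_ℝ / ‖f k‖ ^ 2 := by
  simp [frameCoeff, hk]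

/-- The coefficients are affine: `Γ_k = 2N₀ + (continuous linear functional)`. [cite: DelellisKwon2022, Lemma 3.3 ("affine functions")] -/
theorem frameCoeff_eq_const_add_clm (k : Fin 4) :
    ∃ L : ℝ³ →L[ℝ] ℝ, ∀ u, frameCoeff f N₀ k u = 2 * N₀ + L u := by
  by_cases hk : k = 3
  · subst hk
    exact ⟨0, fun u => by simp⟩
  · refine ⟨(‖f k‖ ^ 2)⁻¹ • innerSL ℝ (f k), fun u => ?_⟩
    rw [frameCoeff_of_ne_three hk]
    show _ = 2 * N₀ + (‖f k‖ ^ 2)⁻¹ • (innerSL ℝ (f k) u)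
    rw [innerSL_apply_apply, real_inner_comm, smul_eq_mul, div_eq_inv_mul]

/-- The coefficients are smooth. [cite: DelellisKwon2022, Lemma 3.3] -/
theorem contDiff_frameCoeff (k : Fin 4) {n : WithTop ℕ∞} : ContDiff ℝ n (frameCoeff f N₀ k) := by
  obtain ⟨L, hL⟩ := frameCoeff_eq_const_add_clm (f := f) (N₀ := N₀) k
  have : frameCoeff f N₀ k = fun u => 2 * N₀ + L u := funext hL
  rw [this]
  exact contDiff_const.add L.contDiff

/-- Uniform bounds of every order for the derivatives of the (affine, smooth) coefficients on the
compact ball `|u| ≤ N₀`. [folklore] -/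
theorem exists_bound_iteratedFDeriv_frameCoeff (k : Fin 4) (m : ℕ) :
    ∃ C : ℝ, ∀ u : ℝ³, ‖u‖ ≤ N₀ → ‖iteratedFDeriv ℝ m (frameCoeff f N₀ k) u‖ ≤ C := by
  have hc : Continuous (iteratedFDeriv ℝ m (frameCoeff f N₀ k)) :=
    ContDiff.continuous_iteratedFDeriv (m := m) (by exact_mod_cast le_top)
      (contDiff_frameCoeff (f := f) (N₀ := N₀) (n := ∞) k)
  obtain ⟨C, hC⟩ := (isCompact_closedBall (0 : ℝ³) N₀).exists_bound_of_continuousOn hc.continuousOn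
  exact ⟨C, fun u hu => hC u (mem_closedBall_zero_iff.2 hu)⟩

/-- **The frame decomposition `u = ∑ₖ Γ_k(u) f_k`** for an orthogonal frame `f₀, f₁, f₂` of nonzero
vectors and `f₃ = -(f₀ + f₁ + f₂)`: the constant parts cancel (`2N₀ ∑ₖ f_k = 0`) and
`∑_{k<3} (⟪u,f_k⟫/|f_k|²) f_k = u`. [cite: DelellisKwon2022, Lemma 3.3] -/
theorem sum_frameCoeff_smul (h01 : ⟪f 0, f 1⟫_ℝ = 0) (h02 : ⟪f 0, f 2⟫_ℝ = 0) (h12 : ⟪f 1, f 2⟫_ℝ = 0)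
    (hne0 : f 0 ≠ 0) (hne1 : f 1 ≠ 0) (hne2 : f 2 ≠ 0) (h3 : f 3 = -(f 0 + f 1 + f 2)) (u : ℝ³) :
    ∑ k, frameCoeff f N₀ k u • f k = u := by
  -- the orthogonal frame is a basis of `ℝ³`
  set e : Fin 3 → ℝ³ := ![f 0, f 1, f 2] with he
  have he0 : e 0 = f 0 := rfl
  have he1 : e 1 = f 1 := rfl
  have he2 : e 2 = f 2 := rfl
  have hne : ∀ i, e i ≠ 0 := fun i => by fin_cases i <;> assumption
  have h10 : ⟪f 1, f 0⟫_ℝ = 0 := by rw [real_inner_comm]; exact h01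
  have h20 : ⟪f 2, f 0⟫_ℝ = 0 := by rw [real_inner_comm]; exact h02
  have h21 : ⟪f 2, f 1⟫_ℝ = 0 := by rw [real_inner_comm]; exact h12
  have horth : Pairwise fun i j => ⟪e i, e j⟫_ℝ = 0 := fun i j hij => by
    fin_cases i <;> fin_cases j <;> first | exact (hij rfl).elim | assumption
  have hli : LinearIndependent ℝ e := linearIndependent_of_ne_zero_of_inner_eq_zero hne horth
  have hcard : Fintype.card (Fin 3) = Module.finrank ℝ ℝ³ := by simp
  set B := basisOfLinearIndependentOfCardEqFinrank hli hcard with hB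
  have hBe : ∀ i, B i = e i := fun i => by rw [hB, coe_basisOfLinearIndependentOfCardEqFinrank]
  -- coordinates of `u` in the frame are `⟪u, f_k⟫/|f_k|²`
  have hrepr : u = ∑ i, B.repr u i • e i := by
    conv_lhs => rw [← B.sum_repr u]
    exact Finset.sum_congr rfl fun i _ => by rw [hBe]
  have hcoord : ∀ j : Fin 3, B.repr u j = ⟪u, e j⟫_ℝ / ‖e j‖ ^ 2 := by
    intro j
    have hj : ⟪u, e j⟫_ℝ = B.repr u j * ‖e j‖ ^ 2 := by
      conv_lhs => rw [hrepr]
      rw [sum_inner, Finset.sum_eq_single j]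
      · rw [real_inner_smul_left, real_inner_self_eq_norm_sq]
      · intro i _ hij
        rw [real_inner_smul_left, horth hij, mul_zero]
      · intro h; exact (h (Finset.mem_univ j)).elim
    have hpos : 0 < ‖e j‖ ^ 2 := by
      have := hne j
      positivity
    rw [hj, mul_div_cancel_right₀ _ hpos.ne']
  have hu : u = ∑ i : Fin 3, (⟪u, e i⟫_ℝ / ‖e i‖ ^ 2) • e i := by
    conv_lhs => rw [hrepr]
    exact Finset.sum_congr rfl fun i _ => by rw [hcoord i]
  rw [Fin.sum_univ_three, he0, he1, he2] at hu
  -- assemble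
  rw [Fin.sum_univ_four, frameCoeff_three, frameCoeff_of_ne_three (by decide),
    frameCoeff_of_ne_three (by decide), frameCoeff_of_ne_three (by decide), h3]
  conv_rhs => rw [hu]
  simp only [add_smul, smul_neg, smul_add]
  abel

/-- **Lower bound `Γ_k(u) ≥ N₀`** for `|u| ≤ N₀` when `|f_k| ≥ 1` (`|⟪u,f_k⟫|/|f_k|² ≤ |u|/|f_k| ≤ N₀`).
[cite: DelellisKwon2022, Lemma 3.3 (proof, "|Γ_{f_k}(u)| ≥ 2N₀ - |u|/|f_k| ≥ N₀")] -/
theorem le_frameCoeff (hnorm : ∀ k, 1 ≤ ‖f k‖) (hN₀ : 0 ≤ N₀) (k : Fin 4) {u : ℝ³} (hu : ‖u‖ ≤ N₀) :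
    N₀ ≤ frameCoeff f N₀ k u := by
  by_cases hk : k = 3
  · subst hk; simp; linarith
  · rw [frameCoeff_of_ne_three hk]
    have hf : 1 ≤ ‖f k‖ := hnorm k
    have hf0 : 0 < ‖f k‖ := by linarith
    have h1 : |⟪u, f k⟫_ℝ / ‖f k‖ ^ 2| ≤ N₀ := by
      rw [abs_div, abs_of_pos (by positivity : 0 < ‖f k‖ ^ 2), div_le_iff₀ (by positivity)]
      calc |⟪u, f k⟫_ℝ| ≤ ‖u‖ * ‖f k‖ := abs_real_inner_le_norm _ _
        _ ≤ N₀ * ‖f k‖ := by gcongr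
        _ = N₀ * ‖f k‖ * 1 := (mul_one _).symm
        _ ≤ N₀ * ‖f k‖ * ‖f k‖ := by gcongr
        _ = N₀ * ‖f k‖ ^ 2 := by ring
    have := (abs_le.1 h1).1
    linarith

/-- **De Lellis–Kwon 2022, Lemma 3.3 (Geometric Lemma II)**, in its printed shape: for an orthogonal
frame `f₀, f₁, f₂` of vectors of length `≥ 1` (e.g. in `ℤ³ ∖ {0}`) and `f₃ = -(f₀ + f₁ + f₂)`, and
any `N₀ ≥ 0`, the affine smooth functions `Γ_k = DLK.frameCoeff f N₀ k` take values in `[N₀, ∞)`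
on `𝒱_{N₀} = {|u| ≤ N₀}` and `u = ∑ₖ Γ_k(u) f_k` for all `u`. [cite: DelellisKwon2022, Lemma 3.3] -/
theorem geometric_lemma_frame (h01 : ⟪f 0, f 1⟫_ℝ = 0) (h02 : ⟪f 0, f 2⟫_ℝ = 0) (h12 : ⟪f 1, f 2⟫_ℝ = 0)
    (hnorm : ∀ k, 1 ≤ ‖f k‖) (h3 : f 3 = -(f 0 + f 1 + f 2)) (hN₀ : 0 ≤ N₀) :
    (∀ k, ContDiff ℝ ∞ (frameCoeff f N₀ k)) ∧
      (∀ k (u : ℝ³), ‖u‖ ≤ N₀ → N₀ ≤ frameCoeff f N₀ k u) ∧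
      ∀ u : ℝ³, u = ∑ k, frameCoeff f N₀ k u • f k := by
  have hne : ∀ k, f k ≠ 0 := fun k h => by
    have := hnorm k
    rw [h, norm_zero] at this
    linarith
  exact ⟨fun k => contDiff_frameCoeff k, fun k u hu => le_frameCoeff hnorm hN₀ k hu,
    fun u => (sum_frameCoeff_smul h01 h02 h12 (hne 0) (hne 1) (hne 2) h3 u).symm⟩

end Frame

end DLK

end Literature.Analysis.FluidPDE
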